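import Literature.IUT.HodgeTheaters.ThetaEllBridgeIsoFNonVacuity
import Literature.IUT.HodgeTheaters.PMBaseProcessionsProofs
import HarnessLib

/-!
# [IUTchI] Rmk 6.12.2 (ii) / Def 6.13 (i) — NON-VACUITY of the isomorphism record of Θ^{±ell}NF-Hodge theaters
# `S5Local.ThetaPMEllNFHT.Iso` (row «NV-L5/S5Local.ThetaPMEllNFHT.Iso»)

Mochizuki, *Inter-universal Teichmüller theory I*, kurims manuscript (May 2020), Remark 6.12.2 (ii)
pp. 174–175 ("one may verify analogues of these results for such Θ^{±ell}NF-Hodge theaters"), Def 6.13 (i)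
p. 182 (Θ^{±ell}NF-Hodge theaters), Def 6.1 (i) p. 155 (`𝔽_l^±`-groups).  PROOF-ONLY companion (no `def`, no
`instance`, no `structure`) of `ThetaPMEllNFHodgeTheatersIso.lean` (abc-iut-L5-t5: the record
`PMBaseKit.S5Local.ThetaPMEllNFHT.Iso NI X₁ X₂` = an `ℱ`-level isomorphism `pm` of the Θ^{±ell}-Hodge theaters
+ a ΘNF-side isomorphism `nf` of the kit `NI` + the compatibility `compat` of the induced bijections of index
sets through the gluings `J ⥲ T^⋇`).  abc-iut-w5-d197's INHABITATION CENSUS L5 v1 lists it among the four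
[hom] rows with ZERO producers; this file records, kernel-checked:

* `FlPMGroup.apply_eq_or_eq_neg_of_trans_mem` / `toAbs_apply_of_trans_mem` — the `𝔽_l^±`-GROUP fact behind
  the compatibility: a self-bijection of an `𝔽_l^±`-group `T` that pulls charts back to charts (= "an
  isomorphism of `𝔽_l^±`-groups `T ⥲ T`", Def 6.4 (i)) is `t ↦ ±t` in every chart, hence induces the
  IDENTITY on `|T| = T/{±1}` (the charts form ONE `{±1}`-orbit, Def 6.1 (i));
* `ThetaPMEllNFHT.Iso.nonempty_of_isoF` — hence, over ANY kits `(K, M, FK, N, NI)`: an `ℱ`-level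
  SELF-isomorphism `pm` of `X.pmEll` together with a ΘNF-side self-isomorphism `nf` of `X.thNF` inducing the
  identity on `J` ALWAYS satisfy `compat` — an inhabitant of `Iso NI X X`;
* `ThetaPMEllNFHT.Iso.nonempty_of_isomFtoDBijective` — so under Cor 5.3 (ii) BY NAME (`FKit.IsomFtoDBijective`;
  the `ℱ`-level self-isomorphism then exists by `FKit.ThetaPMEllHT.IsoF.nonempty_of_isomFtoDBijective`,
  `ThetaEllBridgeIsoFNonVacuity.lean`) the only remaining input is a ΘNF-side self-isomorphism with identity
  index map (the kit `IsoKit` carries no `refl`, so this stays a datum BY NAME);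
* `ThetaPMEllNFHT.Iso.nonempty_toy` — on a CLOSED TERM: abc-iut-L5's toy Θ^{±ell}NF-Hodge theater
  `S5Local.ThetaPMEllNFHT.toy l hl hlo` with the toy isomorphism kit `S5Local.IsoKit.toyTheta l hl`
  (`ThetaPMEllNFHodgeTheatersToy.lean`; ΘNF-side isomorphism type `PUnit`, index map the identity), any odd
  prime `l` [toy]; `exists_toy` at `l = 3`.

HONEST LABEL: toy (closed term) + by-name (general kits).  Nothing of [IUTchI] is asserted; a witness is
consistency evidence only ("type inhabited"). [claim: Mochizuki2012, status: disputed]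
-/

namespace Literature.IUT.HodgeTheaters

open CategoryTheory

universe u

/-! ### `𝔽_l^±`-group automorphisms act trivially on `|T|` -/

namespace FlPMGroup

variable {l : ℕ} {E : Type*} (S : FlPMGroup l E)

/-- **IUTchI:Def6.1(i)** (kurims p.155) A self-bijection `κ` of an `𝔽_l^±`-group `T` pulling charts back to
charts ("an isomorphism of `𝔽_l^±`-groups", Def 6.4 (i) p. 162) is `± id` in every chart: `κ t = t` or
`κ t = −t` — because the charts form a single `{±1}`-orbit. [claim: Mochizuki2012, status: disputed] -/
theorem apply_eq_or_eq_neg_of_trans_mem (κ : E ≃ E) (hκ : ∀ e ∈ S.charts, κ.trans e ∈ S.charts) (t : E) :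
    κ t = t ∨ κ t = S.neg t := by
  obtain ⟨ε, hε⟩ := S.exists_sign_of_mem S.chart₀_mem (hκ S.chart₀ S.chart₀_mem)
  have h : S.chart₀ (κ t) = ε • S.chart₀ t := by
    have h' := congrArg (fun f : E ≃ ZMod l => f t) hε
    simpa using h'
  rcases Int.units_eq_one_or ε with rfl | rfl
  · left
    apply S.chart₀.injective
    simpa using h
  · right
    apply S.chart₀.injective
    rw [S.chart_neg S.chart₀_mem, h, Units.neg_smul, one_smul]

/-- **IUTchI:Def6.4(i)** (kurims p.162) Consequently such a `κ` induces the IDENTITY on `|T| = T/{±1}`: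
`|κ t| = |t|`. [claim: Mochizuki2012, status: disputed] -/
theorem toAbs_apply_of_trans_mem (κ : E ≃ E) (hκ : ∀ e ∈ S.charts, κ.trans e ∈ S.charts) (t : E) :
    S.toAbs (κ t) = S.toAbs t :=
  ((S.toAbs_eq_toAbs_iff t (κ t)).2 (S.apply_eq_or_eq_neg_of_trans_mem κ hκ t)).symm

end FlPMGroup

namespace PMBaseKit

variable {l : ℕ} {K : PMBaseKit.{u} l} {M : K.MultKit} {FK : K.FKit M} {N : K.S5Local M FK}

namespace S5Local

namespace ThetaPMEllNFHT

/-- **IUTchI:Rmk6.12.2(ii)** (kurims pp.174–175) Over ANY kits: an `ℱ`-level SELF-isomorphism `pm` of the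
Θ^{±ell}-Hodge theater `X.pmEll` and a ΘNF-side self-isomorphism `nf` of `X.thNF` inducing the identity on the
index set `J` form an isomorphism of the Θ^{±ell}NF-Hodge theater `X` with itself — the compatibility square
through the gluing `J ⥲ T^⋇` commutes because `pm`'s index bijection is an `𝔽_l^±`-group automorphism of `T`,
hence the identity on `|T|` (`FlPMGroup.toAbs_apply_of_trans_mem`). [claim: Mochizuki2012, status: disputed] -/
theorem Iso.nonempty_of_isoF (NI : N.IsoKit) {hl : Odd l} (X : N.ThetaPMEllNFHT hl)
    (pm : FKit.ThetaPMEllHT.IsoF X.pmEll X.pmEll) (nf : NI.thIso X.thNF X.thNF)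
    (hnf : ∀ j, NI.thIsoIndex nf j = j) : Nonempty (Iso NI X X) :=
  ⟨{ pm := pm
     nf := nf
     compat := fun j t ht => by
       rw [hnf j, ← ht]
       exact X.pmEll.grpT.toAbs_apply_of_trans_mem _ pm.toD.pmIso.indexEquiv_charts t }⟩

/-- **IUTchI:Rmk6.12.2(ii)** (kurims pp.174–175) Under Cor 5.3 (ii) BY NAME (`FKit.IsomFtoDBijective`) the
`ℱ`-level self-isomorphism exists (`FKit.ThetaPMEllHT.IsoF.nonempty_of_isomFtoDBijective`), so a Θ^{±ell}NF-Hodge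
theater `X` has an inhabited isomorphism record `Iso NI X X` as soon as the isomorphism kit supplies ONE
ΘNF-side self-isomorphism of `X.thNF` with identity index map (a datum BY NAME: `IsoKit` has no `refl`).
[claim: Mochizuki2012, status: disputed] -/
theorem Iso.nonempty_of_isomFtoDBijective (NI : N.IsoKit) (h : FK.IsomFtoDBijective) {hl : Odd l}
    (X : N.ThetaPMEllNFHT hl) (nf : NI.thIso X.thNF X.thNF) (hnf : ∀ j, NI.thIsoIndex nf j = j) :
    Nonempty (Iso NI X X) :=
  (FKit.ThetaPMEllHT.IsoF.nonempty_of_isomFtoDBijective h X.pmEll X.pmEll).elim fun pm =>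
    Iso.nonempty_of_isoF NI X pm nf hnf

/-- **IUTchI:Def6.13(i)** (kurims p.182) CLOSED-TERM TOY WITNESS: abc-iut-L5's toy Θ^{±ell}NF-Hodge theater
`S5Local.ThetaPMEllNFHT.toy l hl hlo` (toy Θ^{±ell}-Hodge theater ⧺ toy ΘNF-Hodge theater ⧺ the Rmk 6.12.2 (i)
gluing, over `FKit.toy` where Cor 5.3 (ii) holds: `isomFtoDBijective_toy`) has an inhabited isomorphism record
for the toy isomorphism kit `S5Local.IsoKit.toyTheta l hl` (ΘNF-side isomorphisms `PUnit`, index map `id`), for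
every odd prime `l`. [claim: Mochizuki2012, status: disputed] -/
theorem Iso.nonempty_toy (l : ℕ) [Fact l.Prime] (hl : l ≠ 2) (hlo : Odd l) :
    Nonempty (Iso (IsoKit.toyTheta l hl) (ThetaPMEllNFHT.toy l hl hlo) (ThetaPMEllNFHT.toy l hl hlo)) :=
  Iso.nonempty_of_isomFtoDBijective _ (FKit.isomFtoDBijective_toy l hl) _ PUnit.unit fun _ => rfl

/-- **IUTchI:Def6.13(i)** (kurims p.182) The closed-term witness in existential form (`l = 3`): some
Θ^{±ell}NF-Hodge theater over some kits carries an inhabited isomorphism record. [claim: Mochizuki2012, status: disputed] -/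
theorem Iso.exists_toy :
    ∃ (l : ℕ) (_ : Fact l.Prime) (hl : l ≠ 2) (hlo : Odd l)
      (X : (S5Local.toyTheta l hl).ThetaPMEllNFHT hlo), Nonempty (Iso (IsoKit.toyTheta l hl) X X) :=
  ⟨3, ⟨Nat.prime_three⟩, by decide, ⟨1, rfl⟩, _, @Iso.nonempty_toy 3 ⟨Nat.prime_three⟩ (by decide) ⟨1, rfl⟩⟩

end ThetaPMEllNFHT

end S5Local

end PMBaseKit

end Literature.IUT.HodgeTheaters
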